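import Summits.CriticalPhenomena.PercolationContinuityZ3.Theorems.Transplant.FKConnectivityAllQAntipodalAnd4Path
import HarnessLib

/-!
# Connectivity correlation inequalities for `φ_{w,q}`, every `q > 0` — file 31a′: bookkeeping for the 3-STAR induction — erasing the terminal
# edge of a two-terminal series–parallel network, the degenerate smaller stars, and the AND configuration of the star

Support file (`--supports stmt-CriticalPhenomena-4575`), FK sub-lane `prim-bschramm-fk-2` (gen 19) of the post-continuity programme; builds
on p205010 (kernel theorem, internal audit signed; external expert review pending).  No definitions, no named facts, no sorries; standard axioms.

* `FK.IsTTSP.erase_terminal_edge` — `K` TTSP between `s, t`, `st ∈ K ≠ {st}` ⇒ `K \ st` is TTSP between `s, t` (the terminal edge of a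
  two-terminal series–parallel network is a parallel strand: a series composition never contains it).  This is what lets the star induction of
  file 31b (`and_star3_drift_nonpos_of_isTTSP`) recurse on `E₁ \ om` when the virtual root edge `om` of the series child `E₁(o,m)` is already
  an edge — by induction on the NUMBER OF EDGES rather than on the derivation.
* `FK.star3_triple_eq_pair_left/right` — when the virtual root edge coincides with a star edge (`om = ao` or `om = oc`) the smaller star
  `{ao, om, oc}` is the pair `{ao, oc}`;  `FK.erase_erase_union_star3_eq` — `(K \ {ao, oc}) ∪ {ao, ob, oc} = K ∪ {ob}`.
[cite: Grimmett2006, §3.8 (pp. 61–62)]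
-/

noncomputable section

namespace Summit.CriticalPhenomena.PercolationContinuityZ3.Theorems

namespace FK

open SimpleGraph Literature.Probability.LatticeModels Literature.Probability.Percolation
open scoped Classical

variable {V : Type*} [Fintype V]

/-! ### Erasing the terminal edge -/

section Erase

omit [Fintype V] in
/-- **The terminal edge is a parallel strand**: if `K` is TTSP between `s, t` and contains the edge `st` but is not reduced to it, then
`K \ st` is TTSP between `s, t`. [folklore] -/
theorem IsTTSP.erase_terminal_edge {K : Finset (Sym2 V)} {s t : V} (hK : IsTTSP K s t) :
    s(s, t) ∈ K → K ≠ {s(s, t)} → IsTTSP (K.erase s(s, t)) s t := by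
  induction hK with
  | @edge s t hst => intro _ hne; exact absurd rfl hne
  | @series E₁ E₂ s m t h₁ h₂ hd hV hs ht _ _ =>
    intro hmem _
    exfalso
    rcases Finset.mem_union.1 hmem with h' | h'
    · exact ht _ h' (Sym2.mem_mk_right s t)
    · exact hs _ h' (Sym2.mem_mk_left s t)
  | @parallel E₁ E₂ s t h₁ h₂ hd hV ih₁ ih₂ =>
    intro hmem _
    rcases Finset.mem_union.1 hmem with h' | h'
    · have hn₂ : s(s, t) ∉ E₂ := Finset.disjoint_left.1 hd h'
      rw [erase_union_of_notMem_right hn₂]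
      by_cases hE : E₁ = {s(s, t)}
      · rw [hE, Finset.erase_singleton, Finset.empty_union]; exact h₂
      · exact IsTTSP.parallel (ih₁ h' hE) h₂ (Finset.disjoint_of_subset_left (Finset.erase_subset _ _) hd)
          (fun z hz₁ hz₂ => hV z (by obtain ⟨e, he, hze⟩ := hz₁; exact ⟨e, Finset.mem_of_mem_erase he, hze⟩) hz₂)
    · have hn₁ : s(s, t) ∉ E₁ := Finset.disjoint_right.1 hd h'
      rw [erase_union_of_notMem_left hn₁]
      by_cases hE : E₂ = {s(s, t)}
      · rw [hE, Finset.erase_singleton, Finset.union_empty]; exact h₁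
      · exact IsTTSP.parallel h₁ (ih₂ h' hE) (Finset.disjoint_of_subset_right (Finset.erase_subset _ _) hd)
          (fun z hz₁ hz₂ => hV z hz₁ (by obtain ⟨e, he, hze⟩ := hz₂; exact ⟨e, Finset.mem_of_mem_erase he, hze⟩))

end Erase

/-! ### Star bookkeeping -/

section StarBook

omit [Fintype V] in
/-- Degenerate smaller star: if `om = ao` then `{ao, om, oc} = {ao, oc}`. [folklore] -/
theorem star3_triple_eq_pair_left {o a c m : V} (h : s(o, m) = s(a, o)) (X : Finset (Sym2 V)) :
    X ∪ {s(a, o), s(o, m), s(o, c)} = X ∪ {s(a, o), s(o, c)} := by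
  rw [h]; ext e; simp only [Finset.mem_union, Finset.mem_insert, Finset.mem_singleton]; tauto

omit [Fintype V] in
/-- Degenerate smaller star: if `om = oc` then `{ao, om, oc} = {ao, oc}`. [folklore] -/
theorem star3_triple_eq_pair_right {o a c m : V} (h : s(o, m) = s(o, c)) (X : Finset (Sym2 V)) :
    X ∪ {s(a, o), s(o, m), s(o, c)} = X ∪ {s(a, o), s(o, c)} := by
  rw [h]; ext e; simp only [Finset.mem_union, Finset.mem_insert, Finset.mem_singleton]; tauto

omit [Fintype V] in
/-- The AND configuration: `(K \ {ao, oc}) ∪ {ao, ob, oc} = K ∪ {ob}` for `ao, oc ∈ K`. [folklore] -/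
theorem erase_erase_union_star3_eq {K : Finset (Sym2 V)} {o a b c : V} (hao : s(a, o) ∈ K) (hoc : s(o, c) ∈ K) :
    (K.erase s(a, o)).erase s(o, c) ∪ {s(a, o), s(o, b), s(o, c)} = insert s(o, b) K := by
  ext e
  simp only [Finset.mem_union, Finset.mem_erase, Finset.mem_insert, Finset.mem_singleton]
  constructor
  · rintro (⟨_, _, he⟩ | rfl | rfl | rfl)
    · exact Or.inr he
    · exact Or.inr hao
    · exact Or.inl rfl
    · exact Or.inr hoc
  · rintro (rfl | he)
    · exact Or.inr (Or.inr (Or.inl rfl))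
    · by_cases h1 : e = s(a, o)
      · exact Or.inr (Or.inl h1)
      · by_cases h2 : e = s(o, c)
        · exact Or.inr (Or.inr (Or.inr h2))
        · exact Or.inl ⟨h2, h1, he⟩

end StarBook

end FK

end Summit.CriticalPhenomena.PercolationContinuityZ3.Theorems

end
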